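import Literature.Geometry.Kaehler.SiegelTorusThetaEmbeddingTypeD
import HarnessLib

/-!
# A Lefschetz family embeds the torus — with the homogeneous coordinates of the embedding recorded

Layer `Literature/Geometry/Kaehler`, namespace `Literature.Geometry.Kaehler`.  THEOREMS ONLY (no definition, no
named fact, no instance).  Generic leaf (cell `hodgecm-mathlib`, (U)-lane node U-aΘ, leaf L4 «a positive class has a
power which is the class of an AMPLE divisor»).

★ `ComplexTorus.exists_embedding_of_lefschetzFamily` (`SiegelTorusThetaEmbeddingTypeD`) packages the manifold half of
the classical proof of Lefschetz's theorem: a finite family `(f_k)_{k ∈ K}` of entire functions on `ℂⁿ` with a common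
factor of automorphy for the lattice `Φ(ℤ^ι)`, no common zero, separating points modulo the lattice and separating
tangent vectors, defines an injective holomorphic immersion `F : X = ℂⁿ/Φ(ℤ^ι) → ℙᴺ(ℂ)`.  Its statement only asserts
the EXISTENCE of such an `F`; the present file re-runs the same proof (verbatim) and RECORDS THE COORDINATES:
`ComplexTorus.exists_embedding_of_lefschetzFamily_eq_mk` — there are `N`, an enumeration `σ : Fin (N + 1) ≃ K`, and
`F` as above with, in addition, **`F (π z) = [f_{σ 0}(z) : ⋯ : f_{σ N}(z)]`** for every `z ∈ ℂⁿ`.  This is the form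
needed to read the affine coordinates of an algebraisation of `F` (the hyperplane class of the theta map,
★ `HodgeTheory.picClass_cartierDivisorLineBundle_divisor_eq_toPic`).
HC_CM is proved only modulo the 7 printed citations until rung 0 closes.

## References
* [GriffithsHarris1978] P. Griffiths, J. Harris, *Principles of Algebraic Geometry* (1978), Ch. 2 §6 (the Lefschetz
  theorem), pp. 317–321.
* [LangeBirkenhake1992] H. Lange, Ch. Birkenhake, *Complex Abelian Varieties* (1992), Thm. 4.5.1.
* [MumfordAV1970] D. Mumford, *Abelian Varieties* (1970), §3 (Theorem of Lefschetz), pp. 29–33.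
-/

noncomputable section

open scoped Manifold ContDiff Topology LinearAlgebra.Projectivization Real
open Set Filter Complex
open Literature.Analysis.SpecialFunctions Literature.Analysis.Complex

namespace Literature.Geometry.Kaehler

section LefschetzFamily

variable {ι : Type} [Fintype ι] {n : ℕ}

/-- **A Lefschetz family embeds the torus, with coordinates.** Let `X = ℂⁿ/Φ(ℤ^ι)` be a complex torus and
`(f_k)_{k ∈ K}` a finite family of entire functions on `ℂⁿ` with (i) a common factor of automorphy along every
lattice vector, (ii) no common zero, (iii) `f_k(z₂) = γ f_k(z₁)` for all `k` only if `z₂ - z₁ ∈ Φ(ℤ^ι)`, and (iv)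
`∂_u f_k(z) = μ f_k(z)` for all `k` only if `u = 0`.  Then for some enumeration `σ : Fin (N + 1) ≃ K` the map
`π(z) ↦ [f_{σ 0}(z) : ⋯ : f_{σ N}(z)]` is a well-defined `F : X → ℙᴺ(ℂ)` which is holomorphic, injective and an
immersion — and `F (π z) = [f_{σ j}(z)]_j` (the manifold half of the classical proof of Lefschetz's theorem, with the
homogeneous coordinates recorded). [cite: GriffithsHarris1978, Ch. 2 §6 pp. 317–321]
[cite: LangeBirkenhake1992, Thm. 4.5.1] [cite: MumfordAV1970, §3 pp. 29–33] -/
theorem ComplexTorus.exists_embedding_of_lefschetzFamily_eq_mk (Φ : (ι → ℝ) ≃L[ℝ] (Fin n → ℂ))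
    {K : Type} [Fintype K] (f : K → (Fin n → ℂ) → ℂ) (hdiff : ∀ k, Differentiable ℂ (f k))
    (hlat : ∀ (z : Fin n → ℂ) (v : ι → ℤ), ∃ e : ℂ, ∀ k,
      f k (z + ComplexTorus.latticeVec Φ v) = e * f k z)
    (hbpf : ∀ z : Fin n → ℂ, ∃ k, f k z ≠ 0)
    (hinj : ∀ (z₁ z₂ : Fin n → ℂ) (γ : ℂ), (∀ k, f k z₂ = γ * f k z₁) →
      ∃ v : ι → ℤ, z₂ = z₁ + ComplexTorus.latticeVec Φ v)
    (himm : ∀ (z u : Fin n → ℂ) (μ : ℂ), (∀ k, fderiv ℂ (f k) z u = μ * f k z) → u = 0) :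
    ∃ (N : ℕ) (σ : Fin (N + 1) ≃ K) (F : ComplexTorus Φ → ℙ ℂ (Fin (N + 1) → ℂ)),
      ContMDiff 𝓘(ℂ, Fin n → ℂ) 𝓘(ℂ, Fin N → ℂ) ω F ∧ Function.Injective F ∧
        (∀ x, Function.Injective (mfderiv 𝓘(ℂ, Fin n → ℂ) 𝓘(ℂ, Fin N → ℂ) F x)) ∧
        ∀ (z : Fin n → ℂ) (hz : (fun j ↦ f (σ j) z) ≠ 0),
          F (ComplexTorus.cover Φ z) = Projectivization.mk ℂ (fun j ↦ f (σ j) z) hz := by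
  -- adapted verbatim from ★ `ComplexTorus.exists_embedding_of_lefschetzFamily` (conjunct (4) added)
  have hKpos : 0 < Fintype.card K := by
    obtain ⟨k, -⟩ := hbpf 0
    exact Fintype.card_pos_iff.mpr ⟨k⟩
  have hcard : Fintype.card K = (Fintype.card K - 1) + 1 := by omega
  set N : ℕ := Fintype.card K - 1 with hN
  set σ : Fin (N + 1) ≃ K := (Fintype.equivFinOfCardEq hcard).symm with hσ
  -- homogeneous coordinates
  set gv : (Fin n → ℂ) → Fin (N + 1) → ℂ := fun z k => f (σ k) z with hgv
  have hgv0 : ∀ z, gv z ≠ 0 := by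
    intro z h0
    obtain ⟨k, hk⟩ := hbpf z
    have := congrFun h0 (σ.symm k)
    simp only [hgv, Equiv.apply_symm_apply, Pi.zero_apply] at this
    exact hk this
  have hgvc : Continuous gv := continuous_pi fun k => (hdiff (σ k)).continuous
  have hgvd : ∀ z k, DifferentiableAt ℂ (fun y => gv y k) z := fun z k => hdiff (σ k) z
  have hgva : ∀ z k, ContDiffAt ℂ ω (fun y => gv y k) z := fun z k =>
    (ThetaRigidity.analyticOnNhd_univ (hdiff (σ k)) z (mem_univ z)).contDiffAt
  set G : (Fin n → ℂ) → ℙ ℂ (Fin (N + 1) → ℂ) := fun z => Projectivization.mk ℂ (gv z) (hgv0 z)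
    with hG
  -- lattice invariance of `G`
  have hGper : ∀ (z : Fin n → ℂ) (v : ι → ℤ), G (z + ComplexTorus.latticeVec Φ v) = G z := by
    intro z v
    obtain ⟨e, he⟩ := hlat z v
    have hcoord : ∀ k, gv (z + ComplexTorus.latticeVec Φ v) k = e * gv z k := fun k => he (σ k)
    have he0 : e ≠ 0 := by
      obtain ⟨k, hk⟩ := hbpf (z + ComplexTorus.latticeVec Φ v)
      intro h0
      apply hk
      have := hcoord (σ.symm k)
      simp only [hgv, Equiv.apply_symm_apply] at this
      rw [this, h0, zero_mul]
    simp only [hG]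
    rw [Projectivization.mk_eq_mk_iff']
    exact ⟨e, funext fun k => by rw [Pi.smul_apply, smul_eq_mul, hcoord k]⟩
  have hGper' : ∀ (z : Fin n → ℂ) (v : ι → ℤ), G (z - ComplexTorus.latticeVec Φ v) = G z := by
    intro z v
    have := hGper (z - ComplexTorus.latticeVec Φ v) v
    rw [sub_add_cancel] at this
    exact this.symm
  -- smoothness of `G`
  have hGsmooth : ContMDiff 𝓘(ℂ, Fin n → ℂ) 𝓘(ℂ, Fin N → ℂ) ω G := fun z =>
    contMDiffAt_projectivizationMk hgv0 hgvc (hgva z)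
  -- the map on the torus
  set F : ComplexTorus Φ → ℙ ℂ (Fin (N + 1) → ℂ) := fun t =>
    G (extChartAt 𝓘(ℂ, Fin n → ℂ) t t) with hF
  have hFcover : ∀ z, F (ComplexTorus.cover Φ z) = G z := by
    intro z
    simp only [hF]
    rw [ComplexTorus.extChartAt_cover_self]
    exact hGper' z _
  have hFsmooth : ContMDiff 𝓘(ℂ, Fin n → ℂ) 𝓘(ℂ, Fin N → ℂ) ω F := by
    intro t
    have hev : F =ᶠ[𝓝 t] G ∘ extChartAt 𝓘(ℂ, Fin n → ℂ) t := by
      filter_upwards [extChartAt_source_mem_nhds (I := 𝓘(ℂ, Fin n → ℂ)) t] with t' ht'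
      have e : t' = ComplexTorus.cover Φ (extChartAt 𝓘(ℂ, Fin n → ℂ) t t') := by
        rw [← ComplexTorus.extChartAt_symm_eq_cover Φ (𝕜 := ℂ) t]
        exact ((extChartAt 𝓘(ℂ, Fin n → ℂ) t).left_inv ht').symm
      calc F t' = F (ComplexTorus.cover Φ (extChartAt 𝓘(ℂ, Fin n → ℂ) t t')) := by rw [← e]
        _ = G (extChartAt 𝓘(ℂ, Fin n → ℂ) t t') := hFcover _
    exact ((hGsmooth _).comp t contMDiffAt_extChartAt).congr_of_eventuallyEq hev
  refine ⟨N, σ, F, hFsmooth, ?_, ?_, fun z hz => hFcover z⟩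
  · -- injectivity
    intro t₁ t₂ h
    obtain ⟨z₁, rfl⟩ := ComplexTorus.cover_surjective Φ t₁
    obtain ⟨z₂, rfl⟩ := ComplexTorus.cover_surjective Φ t₂
    rw [hFcover, hFcover] at h
    simp only [hG] at h
    rw [Projectivization.mk_eq_mk_iff'] at h
    obtain ⟨a, ha⟩ := h
    have hprop : ∀ k, f k z₁ = a * f k z₂ := by
      intro k
      have := congrFun ha (σ.symm k)
      simp only [hgv, Pi.smul_apply, smul_eq_mul, Equiv.apply_symm_apply] at this
      exact this.symm
    obtain ⟨v, hv⟩ := hinj z₂ z₁ a hprop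
    rw [hv, ComplexTorus.cover_add_latticeVec]
  · -- immersion
    intro t
    obtain ⟨z, rfl⟩ := ComplexTorus.cover_surjective Φ t
    have hFmd : MDifferentiableAt 𝓘(ℂ, Fin n → ℂ) 𝓘(ℂ, Fin N → ℂ) F (ComplexTorus.cover Φ z) :=
      (hFsmooth _).mdifferentiableAt (by simp)
    have hchain := mfderiv_comp z hFmd (ComplexTorus.mdifferentiable_cover Φ (𝕜 := ℂ) z)
    rw [ComplexTorus.mfderiv_cover, show F ∘ ComplexTorus.cover Φ = G from funext hFcover] at hchain
    refine (injective_iff_map_eq_zero _).mpr fun u hu => ?_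
    have hu' : mfderiv 𝓘(ℂ, Fin n → ℂ) 𝓘(ℂ, Fin N → ℂ) G z u = 0 := by
      rw [hchain]
      exact hu
    obtain ⟨μ, hμ⟩ := exists_eq_mul_of_mfderiv_projectivizationMk_eq_zero hgv0 hgvc (hgvd z) hu'
    refine himm z u μ fun k => ?_
    have := hμ (σ.symm k)
    simpa only [hgv, Equiv.apply_symm_apply] using this

end LefschetzFamily

end Literature.Geometry.Kaehler

end
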